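import Literature.AlgebraicGeometry.VanGeemen1994.WeilDiscriminantOfCMType
import Literature.AlgebraicGeometry.ComplexMultiplication.RosatiPolarizationCM
import Mathlib.NumberTheory.NumberField.Discriminant.Defs
import HarnessLib

/-!
# Every CM-type realisation `(A, ι)` of `(F, Φ)` carries, for each imaginary quadratic `w ∈ 𝓞_F`, a Rosati polarization
# class with a van Geemen discriminant witness of class `[N_{F⁺/ℚ}(ξ w) · d_{F⁺}]` (Deligne §5 Prop. 5.1, §5 (c); van Geemen 5.2)

Family `hodge`, layer `Literature/AlgebraicGeometry/VanGeemen1994`; KERNEL ONLY (theorems; no definition, no named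
fact).  The ASSEMBLED form of `VanGeemen1994/WeilDiscriminantOfCMType` for the realisations used by the Hodge cells
(`ComplexMultiplication.IsCMTypeRealisation Φ A ι θ`: `ι : 𝓞_F →+* End A`, `θ(a) = ι(a)^*` on `H¹`, one-dimensional
eigenlines — Shimura §5.2 / §6.2, the shape reached from every simple CM abelian variety up to isogeny, e.g.
`CorCM/CMSixfoldRank/SimpleCMSixfoldNondegenerateHodge.exists_isCMTypeRealisation_of_isSimpleCMSixfold`), with NO
further hypothesis:

* the polarization class is Deligne's/Shimura's «polarization whose Rosati involution induces complex conjugation on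
  `E`» — the tree THEOREM `ComplexMultiplication.IsCMTypeRealisation.exists_rosati_kaehlerClass_full` (Shimura §6.2
  Thm. 4 (3); Deligne Thm. 4.8 (a), §5 (c) p. 39 «choose a polarization `θᵢ` for `Aᵢ` whose Rosati involution stabilizes
  `E`»);
* the `K`-basis of `H¹(A, ℚ)` is `(ι bᵢ)^* x₀` for an integral basis `(bᵢ)` of the maximal real subfield `F⁺` (a real
  `ℚ`-basis of `F⁺` inside `𝓞_F`, `exists_real_integral_frame`) and a generator `x₀`;
* the class is READ as `[N_{F⁺/ℚ}(c) · d_{F⁺}]` (`d_{F⁺} = NumberField.discr F⁺`, the discriminant of that integral basis),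
  `c = ξ w ∈ F⁺`, `ξ̄ = -ξ ≠ 0` the coefficient of Deligne's trace formula
  `ψ(x, y) = Tr_{F/ℚ}(ξ x ȳ)` (Prop. 5.1, p. 37) — van Geemen's `det H ∈ ℚ^×/Nm(ℚ(√-D)^×)` of `(A, ℚ(w), Q_h)`
  (Lemma 5.2 (3)); in the cell's words «`disc ≡ N_{F⁺/ℚ}(f) · d_{F⁺}`».

What is NOT here (unchanged): which classes occur as `ξ` varies with the polarization (the arithmetic core (★):
existence of `f ∈ F⁺` with prescribed signs and `N_{F⁺/ℚ}(f) · d_{F⁺} ≡ (-1)ⁿ` — class field theory for `F/F⁺`), the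
positivity/sign pattern of `ξ` at the places of `F⁺` (the CM type `Φ`; no Riemann-form positivity beyond Hodge–Riemann
is recorded on the carriers), and the hyperplane shape of the class in `Markman2025_weilClasses_algebraic_hyperbolicSixfold`.

## References
* [Deligne1982HodgeCycles] P. Deligne, *Hodge cycles on abelian varieties*, LNM 900 (1982), §4 Thm. 4.8 (a), Lemma 4.6;
  §5 Prop. 5.1 and proof (pp. 36–37), §5 (c) (p. 39).
* [vanGeemen1994HodgeAV] B. van Geemen, LNM 1594 (1994), 4.14, Lemma 5.2 (1)–(3).
* [Shimura1998] G. Shimura, *Abelian Varieties with Complex Multiplication and Modular Functions* (1998), §5.2, §6.2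
  Thm. 4 (3).
* [FrohlichTaylor1990] A. Fröhlich, M. J. Taylor, *Algebraic Number Theory*, Ch. I §1 (1.24)–(1.26); Ch. II §1 (integral
  bases).
-/

noncomputable section

open CategoryTheory NumberField Module
open Literature.AlgebraicTopology.SingularHomology
open Literature.AlgebraicGeometry.HodgeTheory
open Literature.AlgebraicGeometry.Motives (AbelianVariety polarizationPairingOne bettiCohomology ComplexPoints
  IsSmoothProjective CMType)
open Literature.AlgebraicGeometry.ComplexMultiplication (IsCMTypeRealisation)
open Literature.NumberTheory.NumberFields

namespace Literature.AlgebraicGeometry.VanGeemen1994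

/-! ### A real integral `ℚ`-basis of `F⁺` inside `𝓞_F` -/

section Frame

variable {F : Type} [Field F] [NumberField F] [IsCMField F]

/-- **A real integral frame.**  If `[F⁺ : ℚ] = m`, there are `b₁, …, b_m ∈ 𝓞_F`, each fixed by complex conjugation,
which are the images of an integral basis of `F⁺ = maximalRealSubfield F` — so a `ℚ`-basis `b'` of `F⁺` with
`(b' i : F) = bᵢ`; in particular the `bᵢ` are `ℚ`-linearly independent in `F`, and `d(b') = d_{F⁺}` is the field
discriminant (Fröhlich–Taylor II §1: `𝓞_{F⁺}` is a free `ℤ`-module of rank `[F⁺ : ℚ]` spanning `F⁺`; the discriminant of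
an integral basis). [cite: FrohlichTaylor1990, Ch. II §1 (integral bases, the absolute discriminant)]
[cite: Deligne1982HodgeCycles, §5 p. 37 («F is totally real … E = F[√α]»)] -/
theorem exists_real_integral_frame {m : ℕ} (hm : Module.finrank ℚ (maximalRealSubfield F) = m) :
    ∃ (b : Fin m → 𝓞 F) (b' : Basis (Fin m) ℚ (maximalRealSubfield F)),
      (∀ i, IsCMField.complexConj F (b i : F) = (b i : F)) ∧ (∀ i, ((b' i : maximalRealSubfield F) : F) = (b i : F)) ∧
        LinearIndependent ℚ (fun i => (b i : F)) ∧
        Algebra.discr ℚ b' = (NumberField.discr (maximalRealSubfield F) : ℚ) := by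
  classical
  set K := maximalRealSubfield F with hK
  have hcard : Fintype.card (Free.ChooseBasisIndex ℤ (𝓞 K)) = m := by
    rw [← Module.finrank_eq_card_basis (integralBasis K), hm]
  let e : Fin m ≃ Free.ChooseBasisIndex ℤ (𝓞 K) := (Fintype.equivFinOfCardEq hcard).symm
  let b : Fin m → 𝓞 F := fun i => algebraMap (𝓞 K) (𝓞 F) (RingOfIntegers.basis K (e i))
  let b' : Basis (Fin m) ℚ K := (integralBasis K).reindex e.symm
  have hb'app : ∀ i, b' i = integralBasis K (e i) := fun i => by
    simp only [b', Basis.reindex_apply, Equiv.symm_symm]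
  have hbb' : ∀ i, ((b' i : K) : F) = (b i : F) := fun i => by
    rw [hb'app, integralBasis_apply]
    change algebraMap K F (algebraMap (𝓞 K) K _) = algebraMap (𝓞 F) F (algebraMap (𝓞 K) (𝓞 F) _)
    rw [← IsScalarTower.algebraMap_apply, ← IsScalarTower.algebraMap_apply]
  have hreal : ∀ i, IsCMField.complexConj F (b i : F) = (b i : F) := fun i =>
    (IsCMField.RingOfIntegers.complexConj_eq_self_iff F (b i)).2
      ⟨RingOfIntegers.basis K (e i), IsScalarTower.algebraMap_apply (𝓞 K) (𝓞 F) F _⟩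
  refine ⟨b, b', hreal, hbb', ?_, ?_⟩
  · have h1 : LinearIndependent ℚ fun i => ((b' i : K) : F) :=
      b'.linearIndependent.map' (K.subtype.toAddMonoidHom.toRatLinearMap)
        (LinearMap.ker_eq_bot.2 Subtype.val_injective)
    convert h1 using 1
    funext i
    exact (hbb' i).symm
  · -- `d(b') = d_{F⁺}`: the (reindexed) integral basis computes the field discriminant
    rw [show b' = (integralBasis K).reindex e.symm from rfl, Basis.coe_reindex, Algebra.discr_reindex,
      ← NumberField.coe_discr]

end Frame

/-! ### The assembled statement for a CM-type realisation -/

section Realisation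

variable {F : Type} [Field F] [NumberField F] [IsCMField F] {Φ : CMType F}
variable {A : AbelianVariety ℂ} {ι : 𝓞 F →+* CategoryTheory.End A} {θ : F →+* Module.End ℂ (complexBetti A.X 1)}

/-- **Every CM-type realisation carries a Rosati polarization class with a van Geemen discriminant witness relative to
any imaginary quadratic `w ∈ 𝓞_F`, of class `[N_{F⁺/ℚ}(ξ w) · d_{F⁺}]`.**  For a realisation `(A, ι, θ)` of `(F, Φ)`
(`IsCMTypeRealisation`) with `[F : ℚ] = 4n`, and `w ∈ 𝓞_F` with `w̄ = -w`, `w² = -D`, `D ≥ 1`: there are a RATIONAL,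
ALGEBRAIC class `h ∈ H²(A(ℂ); ℂ)`, a non-zero real multiple of a Kähler class, with Rosati = conjugation on `𝓞_F`
(Shimura §6.2 Thm. 4 (3) / Deligne Thm. 4.8 (a)); Deligne's coefficient `ξ ∈ F`, `ξ̄ = -ξ ≠ 0` (Prop. 5.1, p. 37:
`ψ(x, y) = Tr_{F/ℚ}(ξ x ȳ)`); and the real scalar `c = ξ w ∈ F⁺`; such that, with `d_{F⁺} = NumberField.discr F⁺` the
absolute discriminant of the maximal real subfield, `N_{F⁺/ℚ}(c) · d_{F⁺} ≠ 0` and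

  `HasWeilDiscriminantNondeg A (ι w) n D h [N_{F⁺/ℚ}(c) · d_{F⁺}]`

— van Geemen's `det H` of the polarized pair `(A, ℚ(w) ≅ ℚ(√-D), Q_h)` is the class of `N_{F⁺/ℚ}(ξ w) · d_{F⁺}`
(Lemma 5.2 (2)–(3); Deligne §5 (c): «the discriminant of `φ` is `∏ fᵢ (ζ₁⁻¹ζᵢ)`»).
[cite: vanGeemen1994HodgeAV, Lemma 5.2 (1)–(3) and 4.14] [cite: Deligne1982HodgeCycles, §4 Thm. 4.8 (a); §5 Prop. 5.1
and proof (pp. 36–37), §5 (c) (p. 39)] [cite: Shimura1998, §6.2 Theorem 4 (3)] -/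
theorem exists_hasWeilDiscriminantNondeg_of_isCMTypeRealisation (hA : IsCMTypeRealisation Φ A ι θ)
    {n : ℕ} (hn : 1 ≤ n) (hF : Module.finrank ℚ F = 4 * n)
    {D : ℕ} (hD : 0 < D) (w : 𝓞 F) (hw : IsCMField.complexConj F (w : F) = -(w : F))
    (hwD : (w : F) ^ 2 = -(D : F)) :
    ∃ h : complexBetti A.X 2, IsRationalClass h ∧ h ∈ algebraicClasses A.X 1 ∧
      (∃ s : ℝ, s ≠ 0 ∧ IsKaehlerClass A.dim A.X ((s : ℂ) • h)) ∧
      (∀ (a ac : 𝓞 F), (ac : F) = IsCMField.complexConj F (a : F) → ∀ x y : complexBetti A.X 1,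
        polarizationPairingOne A.X h (A.dim - 1) (complexBetti.map (ι a).hom.hom.hom 1 x) y =
          polarizationPairingOne A.X h (A.dim - 1) x (complexBetti.map (ι ac).hom.hom.hom 1 y)) ∧
      ∃ (ξ : F) (c : maximalRealSubfield F)
        (hnd : Algebra.norm ℚ c * (NumberField.discr (maximalRealSubfield F) : ℚ) ≠ 0),
        IsCMField.complexConj F ξ = -ξ ∧ ξ ≠ 0 ∧ (c : F) = ξ * (w : F) ∧
          HasWeilDiscriminantNondeg A (ι w) n D h
            (QuotientGroup.mk (Units.mk0 _ hnd) : weilNormResidueGroup D) := by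
  classical
  -- `dim A = 2n`, `[F⁺ : ℚ] = 2n`
  have hAdim : A.dim = 2 * n := by
    have h1 := hA.2.1
    rw [Motives.AbelianVariety.finrank_complexBetti_one, hF] at h1
    omega
  have hFp : Module.finrank ℚ (maximalRealSubfield F) = 2 * n := by
    have h2 := Module.finrank_mul_finrank ℚ (maximalRealSubfield F) F
    rw [Algebra.IsQuadraticExtension.finrank_eq_two (maximalRealSubfield F) F, hF] at h2
    omega
  -- the polarization class (Shimura §6.2 Thm. 4 (3))
  obtain ⟨h, hQ, halg, hK, -, -, hros⟩ := hA.exists_rosati_kaehlerClass_full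
  -- a real integral frame
  obtain ⟨b, b', hreal, hbb', hbi, hdisc⟩ := exists_real_integral_frame (F := F) hFp
  -- the witness of `WeilDiscriminantOfCMType`
  obtain ⟨ξ, hξconj, hξ0, -, hdet, hW⟩ :=
    hasWeilDiscriminantNondeg_of_ringOfIntegers_action ι hn hAdim hF hQ hK hros hD w hw hwD b hreal hbi
  refine ⟨h, hQ, halg, hK, hros, ?_⟩
  -- read the class through `F⁺`
  have hcreal : IsCMField.complexConj F (ξ * (w : F)) = ξ * (w : F) := by
    rw [map_mul, hξconj, hw, neg_mul_neg]
  let c : maximalRealSubfield F := ⟨ξ * (w : F), (IsCMField.complexConj_eq_self_iff F _).1 hcreal⟩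
  have hc0 : c ≠ 0 := fun h0 => by
    have hwz : (w : F) ≠ 0 := fun hz => by
      have e := hwD
      rw [hz, zero_pow two_ne_zero] at e
      exact (Nat.cast_ne_zero.2 hD.ne') (neg_eq_zero.1 e.symm)
    have : (c : F) = 0 := by rw [h0]; rfl
    exact mul_ne_zero hξ0 hwz this
  have hMeq : (Matrix.of fun i j => Algebra.trace ℚ F (ξ * (w : F) * (b i : F) * (b j : F))) =
      Matrix.of fun i j => Algebra.trace ℚ F
        (algebraMap _ F c * algebraMap _ F (b' i) * algebraMap _ F (b' j)) := by
    ext i j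
    simp only [Matrix.of_apply]
    rw [show algebraMap (maximalRealSubfield F) F c = ξ * (w : F) from rfl,
      show algebraMap (maximalRealSubfield F) F (b' i) = (b' i : F) from rfl,
      show algebraMap (maximalRealSubfield F) F (b' j) = (b' j : F) from rfl, hbb', hbb']
  have hdet' : (Matrix.of fun i j => Algebra.trace ℚ F
      (algebraMap _ F c * algebraMap _ F (b' i) * algebraMap _ F (b' j))).det ≠ 0 := hMeq ▸ hdet
  obtain ⟨hnd, hmk⟩ := mk_det_traceMatrix_eq_mk_norm_mul_discr (D := D) b' c hc0 hdet'
  have hnd' : Algebra.norm ℚ c * (NumberField.discr (maximalRealSubfield F) : ℚ) ≠ 0 := by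
    rw [← hdisc]; exact hnd
  refine ⟨ξ, c, hnd', hξconj, hξ0, rfl, ?_⟩
  have hu : Units.mk0 _ hnd' = Units.mk0 _ hnd := (Units.mk0_inj hnd' hnd).2 (by rw [hdisc])
  have hcls : (QuotientGroup.mk (Units.mk0 _ hdet) : weilNormResidueGroup D) = QuotientGroup.mk (Units.mk0 _ hnd') := by
    rw [hu, ← hmk]
    congr 1
    rw [Units.mk0_inj, hMeq]
  rw [hcls] at hW
  exact hW

end Realisation

end Literature.AlgebraicGeometry.VanGeemen1994

end
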